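import Literature.AlgebraicGeometry.AbelianSchemes.MumfordQuotientConstruction
import Literature.AlgebraicGeometry.AbelianSchemes.AbelianSchemeConstSubgroupQuotientSmoothAnyChar
import HarnessLib

/-!
# Mumford's construction of `(A′⁄K′, π, 𝒫′)` with CONSTANT `K(L′)` over an affine locally Noetherian base of ANY characteristic
# — ★ `MumfordQuotientConstruction` with the base field of characteristic `0` REMOVED (letter (Mb′) of the (s2-D) road (A))

Layer `Literature/AlgebraicGeometry/AbelianSchemes`, namespace `Literature.AlgebraicGeometry.AbelianSchemes.AbelianSchemeOver`.
THEOREMS ONLY (no definition, no named fact, no instance, no notation, no `sorry`; net Literature debt 0).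

[MumfordAV1970] §13, Theorem p. 125 (construction half, any characteristic): «`X̂ := X⁄K(L)`, `π : X → X̂` the quotient map, and the
Poincaré bundle `P` on `X × X̂` is the descent of `Λ(L) = m^*L ⊗ p₁^*L⁻¹ ⊗ p₂^*L⁻¹` along `1 × π`»; §7 Thm. 4 p. 72 (quotients by finite
groups); [MumfordFogartyKirwan1994] Ch. 6 §1 Cor. 6.8 (p. 118), §2 (p. 121).  ★ `MumfordQuotientConstruction` (F-3 (M) child line, letter
(Mb)) assembles the relative construction over an affine locally Noetherian base `S′` OVER A FIELD OF CHARACTERISTIC `0`; the ONLY use of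
the characteristic there is the smoothness of `A′⁄K′ → S′` through ★ `smooth_quotientOver_hom_of_hom_spec` (regular geometric fibres over
PERFECT residue fields).  ★ `AbelianSchemeConstSubgroupQuotientSmoothAnyChar` (p847045) proves that smoothness over ANY locally Noetherian
base (EGA IV₄ 17.7.7 ∕ Stacks 05B5 for the affine flat surjective cover `A′ → A′⁄K′`), so the two heads hold verbatim WITHOUT the base
field — this file re-runs the ★ proofs with that one line swapped (every other ingredient — ★ `quotientBy`, ★ `exists_grpObj_isMonHom_quotientMk`,
★ `geometricallyConnected_quotientOver_hom`, ★ `exists_rigidified_descent_mumfordBundle`, ★ `nonempty_equivariantStructure_mumfordBundle`,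
★ `etale_quotientMk_left`, ★ `comp_quotientMk_eq_one_iff_exists_openCover` — was already characteristic-free):

* §1 **`exists_quotient_poincare_of_constant_sections_of_isLocallyNoetherian`** = ★ `exists_quotient_poincare_of_constant_sections`
  minus `{k} [Field k] [CharZero k] (hk : S′ ⟶ Spec k)`;
* §2 **`exists_quotient_poincare_of_constant_kOfL_baseChange_of_isLocallyNoetherian`** = ★ `exists_quotient_poincare_of_constant_kOfL_baseChange`
  minus the same (the letter (Mb′) of the (s2-D) road (A) re-thread at characteristic `p`, B-p04 (g39) census 2026-09-01T22:43:58Z).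

Cell `hodgecm-mathlib` (D-0151), P6 «MOD programme», PAY-DOWN CAPITAL of the printed row P-2′ «DUAL-S» (LEAD F0P6-plan «M-29» (2):
road (A) pieces stay ★ capital at low priority; B-p04 (g40) offer (O3)).  Count-neutral; HC_CM is proved only modulo the printed citations
(2 remaining named inputs hLiu418 24832, h413 24833) until rung 0 closes; nothing here is about HC.

## References
* [MumfordAV1970] D. Mumford, *Abelian Varieties* (1970), §7 (Thm. 4 p. 72, Remark p. 69), §12 Thm. 1 (p. 112), §13 (Thm. p. 125 and its proof).
* [MumfordFogartyKirwan1994] D. Mumford, J. Fogarty, F. Kirwan, *GIT* 3rd ed. (1994), Ch. 6 §1 Cor. 6.8 (p. 118), §2 (p. 121).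
* [MilneAV2008] J. S. Milne, *Abelian Varieties* (v2.00, 2008), I §8 pp. 36–37 and p. 40.
* [Grothendieck1967] A. Grothendieck, *EGA IV₄*, Prop. 17.7.7; [StacksProject] Tag 05B5 (descent of smoothness along fpqc covers of the source).
* Tree: ★ `MumfordQuotientConstruction` (`exists_quotient_poincare_of_constant_sections`, `pullback_unitSection_detClass_baseChange_eq_one`),
  ★ `AbelianSchemeConstSubgroupQuotientSmoothAnyChar` (`smooth_quotientOver_hom_of_isLocallyNoetherian`).
-/

set_option autoImplicit false

noncomputable section

-- `Scheme.Modules` / `SheafOfModules` are not reducible; `(A.quotientBy …).X = A.quotientOver …` holds by `rfl` only (as in ★ `MumfordQuotientConstruction`).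
set_option backward.isDefEq.respectTransparency false

universe u

open CategoryTheory CategoryTheory.Limits AlgebraicGeometry MonoidalCategory
open scoped MonObj

namespace Literature.AlgebraicGeometry.AbelianSchemes

open Literature.AlgebraicGeometry.RelativeSpec Literature.AlgebraicGeometry.Modules
  Literature.AlgebraicGeometry.Motives Literature.AlgebraicGeometry.AbelianVarieties

namespace AbelianSchemeOver

/-! ## §1 The construction over an affine locally Noetherian base of any characteristic, constant `K′ ⊆ K(L′)(S′)` -/

/-- **MUMFORD'S CONSTRUCTION OF `(A′⁄K′, π, 𝒫′)` OVER AN AFFINE BASE, CONSTANT `K′`** ([MumfordAV1970] §13 Theorem p. 125,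
construction half; [MumfordFogartyKirwan1994] Cor. 6.8 ∕ §2 p. 121).  Let `S′` be an affine locally Noetherian scheme (ANY
characteristic — no base field), `A′ → S′` a PROJECTIVE abelian scheme, `L′` a rank-one module on `A′` rigidified along the unit
section, and `K′ ≤ A′(S′)` a finite group of sections, pairwise distinct on every geometric fibre, with `K′ ⊆ K(L′)(S′)`.  Then
there are an abelian scheme `Â′` over `S′`, a HOMOMORPHISM `π : A′ → Â′`, finite étale surjective, whose kernel on every
`T`-valued point is «locally a section of `K′`», and a module `𝒫′` on `A′ ×_{S′} Â′` of rank one, rigidified along `ε × 1`,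
fibrewise in `Pic⁰`, with `(1 × π)^*𝒫′ ≅ Λ(L′)`, such that every finite set of points of `Â′` lies in an affine open.
(`Â′ = A′⁄K′` by translations; `𝒫′` = the rigidified descent of `Λ(L′)` along `1 × π`.) [cite: MumfordAV1970, §13 Theorem (p. 125) and its proof]
[cite: MumfordAV1970, §7 Thm. 4 (p. 72) and Remark p. 69] [cite: MumfordFogartyKirwan1994, Ch. 6 §1 Corollary 6.8 (p. 118) and §2 (p. 121)] -/
theorem exists_quotient_poincare_of_constant_sections_of_isLocallyNoetherian {S' : Scheme.{u}} [IsAffine S']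
    [IsLocallyNoetherian S'] (A' : AbelianSchemeOver S') (hA' : Morphisms.IsProjective A'.X.hom) {L' : A'.left.Modules} (hL' : HasRank L' 1)
    (hε' : CechPic.pullback A'.unitSection (detClass (HasRank.isFiniteLocallyFree' hL')) = 1)
    (K' : Subgroup A'.Sections) [Finite K']
    (hKinj : ∀ (Ω : Type u) [Field Ω] [IsAlgClosed Ω] (s : Spec (.of Ω) ⟶ S') (σ : A'.Sections), σ ∈ K' → σ ≠ 1 →
      A'.restrict s σ ≠ A'.restrict s 1)
    (hKL : ∀ σ : K', A'.MemKOfL L' (σ : A'.Sections)) :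
    ∃ (hat : AbelianSchemeOver S') (π : A'.X ⟶ hat.X) (_ : IsMonHom π) (_ : IsFinite π.left) (_ : Etale π.left)
      (_ : Surjective π.left) (P : (A'.prodLeft hat).Modules),
      (∀ (T : Over S') (x : T ⟶ A'.X), x ≫ π = 1 ↔
        ∃ 𝒱 : Scheme.OpenCover.{u} T.left, ∀ j, ∃ σ : K', 𝒱.f j ≫ x.left = 𝒱.f j ≫ T.hom ≫ (σ : A'.Sections).left) ∧
      HasRank P 1 ∧
      Nonempty ((Scheme.Modules.pullback (A'.unitSlice hat)).obj P ≅ SheafOfModules.unit _) ∧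
      (∀ (Ω : Type u) [Field Ω] [IsAlgClosed Ω] (b : Spec (.of Ω) ⟶ hat.X.left),
        IsHomogeneous (A'.fibre (b ≫ hat.X.hom)).toAbelianVariety ((Scheme.Modules.pullback (A'.fibreSlice hat b)).obj P)) ∧
      Nonempty ((Scheme.Modules.pullback (A'.X ◁ π).left).obj P ≅ A'.mumfordBundle L') ∧
      (∀ F : Finset hat.X.left, ∃ U : hat.X.left.Opens, IsAffineOpen U ∧ ∀ x ∈ F, x ∈ U) := by
  haveI : IsCommMonObj A'.X := A'.isCommMonObj_of_isLocallyNoetherian_base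
  haveI := A'.isProper
  haveI : IsSeparated (A'.X.hom ≫ 𝟙 S') := by rw [Category.comp_id]; infer_instance
  haveI : LocallyOfFiniteType (A'.X.hom ≫ 𝟙 S') := by rw [Category.comp_id]; infer_instance
  -- the four raw hypotheses of ★ `quotientBy`, discharged
  have hfinA : ∀ s : Finset A'.left, ∃ U : A'.left.Opens, IsAffineOpen U ∧ ∀ x ∈ s, x ∈ U := fun s =>
    Morphisms.exists_isAffineOpen_forall_mem_of_isProjective hA' s
  have hcov := A'.translationActionOver_hcov_of_forall_finset (𝟙 S') K' hfinA
  have hfree := A'.forall_comp_translation_ne_of_forall_restrict_ne K' hKinj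
  have hG := A'.exists_grpObj_isMonHom_quotientMk (𝟙 S') K' hcov hfree
  have hsm := A'.smooth_quotientOver_hom_of_isLocallyNoetherian (𝟙 S') K' hcov hfree
  have hgc := A'.geometricallyConnected_quotientOver_hom (𝟙 S') K' hcov
  -- the normalised linearisation of `Λ(L′)` and the rigidified descent
  obtain ⟨Φ⟩ := A'.nonempty_equivariantStructure_mumfordBundle (𝟙 S') K' hcov hL' hε' hKL
  obtain ⟨P, hP1, hrig, hpic, hsock⟩ := A'.exists_rigidified_descent_mumfordBundle (𝟙 S') K' hcov hG hsm hgc hfree hL' hε' Φ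
  exact ⟨A'.quotientBy (𝟙 S') K' hcov hG hsm hgc,
    (show A'.X ⟶ (A'.quotientBy (𝟙 S') K' hcov hG hsm hgc).X from A'.quotientMk (𝟙 S') K' hcov),
    A'.isMonHom_quotientMk (𝟙 S') K' hcov hG hsm hgc, A'.isFinite_quotientMk_left (𝟙 S') K' hcov,
    A'.etale_quotientMk_left (𝟙 S') K' hcov hfree, ⟨A'.quotientMk_left_surjective (𝟙 S') K' hcov⟩, P,
    fun T x => A'.comp_quotientMk_eq_one_iff_exists_openCover (𝟙 S') K' hcov hG hsm hgc hfree x,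
    hP1, hrig, hpic, hsock, A'.exists_isAffineOpen_forall_mem_quotientOver (𝟙 S') K' hcov hfinA⟩

/-! ## §2 The base-changed situation `A′ = A ×_{S} S′`, `L′ = L|_{A′}`, `K(L′)` constant on `K′`, any characteristic -/

/-- **MUMFORD'S CONSTRUCTION IN THE BASE-CHANGED SITUATION `A′ = A ×_S S′`, `L′ = L|_{A′}`, `K(L′)` CONSTANT** — the letter
(Mb) of the F-3 (M) child line up to universe: for `A → S` with a rigidified rank-one `L`, `p : S′ → S` with `S′` affine locally
Noetherian (ANY characteristic), `A′ := A ×_S S′` projective over `S′`, and a finite `K′ ≤ A′(S′)`, pairwise distinct on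
geometric fibres, on which `K(L′)` is the constant functor («`u ∈ K(L′)(T)` iff `u` is locally a section of `K′`»): the
conclusion of §1 with the kernel clause returned in `K(L′)` form. [cite: MumfordAV1970, §13 Theorem (p. 125) and its proof]
[cite: MumfordFogartyKirwan1994, Ch. 6 §1 Corollary 6.8 (p. 118) and §2 (p. 121)] [cite: MilneAV2008, I §8 pp. 36–37] -/
theorem exists_quotient_poincare_of_constant_kOfL_baseChange_of_isLocallyNoetherian {S S' : Scheme.{u}} [IsAffine S']
    [IsLocallyNoetherian S'] (A : AbelianSchemeOver S) {L : A.left.Modules} (hL : HasRank L 1)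
    (hε : CechPic.pullback A.unitSection (detClass (HasRank.isFiniteLocallyFree' hL)) = 1)
    (p : S' ⟶ S) (hA' : Morphisms.IsProjective (A.baseChange p).X.hom)
    (K' : Subgroup (A.baseChange p).Sections) [Finite K']
    (hKinj : ∀ (Ω : Type u) [Field Ω] [IsAlgClosed Ω] (s : Spec (.of Ω) ⟶ S') (σ : (A.baseChange p).Sections),
      σ ∈ K' → σ ≠ 1 → (A.baseChange p).restrict s σ ≠ (A.baseChange p).restrict s 1)
    (hK' : ∀ (T : Over S') (u : T ⟶ (A.baseChange p).X),
      (A.baseChange p).MemKOfL ((Scheme.Modules.pullback (pullback.fst A.X.hom p)).obj L) u ↔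
        ∃ 𝒱 : Scheme.OpenCover.{u} T.left, ∀ j, ∃ σ : K',
          𝒱.f j ≫ u.left = 𝒱.f j ≫ T.hom ≫ (σ : (A.baseChange p).Sections).left) :
    ∃ (hat : AbelianSchemeOver S') (π : (A.baseChange p).X ⟶ hat.X) (_ : IsMonHom π)
      (_ : IsFinite π.left) (_ : Etale π.left) (_ : Surjective π.left)
      (P : ((A.baseChange p).prodLeft hat).Modules),
      (∀ (T : Over S') (u : T ⟶ (A.baseChange p).X),
        u ≫ π = 1 ↔ (A.baseChange p).MemKOfL ((Scheme.Modules.pullback (pullback.fst A.X.hom p)).obj L) u) ∧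
      HasRank P 1 ∧
      Nonempty ((Scheme.Modules.pullback ((A.baseChange p).unitSlice hat)).obj P ≅ SheafOfModules.unit _) ∧
      (∀ (Ω : Type u) [Field Ω] [IsAlgClosed Ω] (b : Spec (.of Ω) ⟶ hat.X.left),
        IsHomogeneous ((A.baseChange p).fibre (b ≫ hat.X.hom)).toAbelianVariety
          ((Scheme.Modules.pullback ((A.baseChange p).fibreSlice hat b)).obj P)) ∧
      Nonempty ((Scheme.Modules.pullback ((A.baseChange p).X ◁ π).left).obj P ≅
        (A.baseChange p).mumfordBundle ((Scheme.Modules.pullback (pullback.fst A.X.hom p)).obj L)) ∧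
      (∀ F : Finset hat.X.left, ∃ U : hat.X.left.Opens, IsAffineOpen U ∧ ∀ x ∈ F, x ∈ U) := by
  -- `K′ ⊆ K(L′)(S′)`: a section IS locally (indeed globally) a section of `K′`
  have hKL : ∀ σ : K', (A.baseChange p).MemKOfL ((Scheme.Modules.pullback (pullback.fst A.X.hom p)).obj L)
      (σ : (A.baseChange p).Sections) := fun σ =>
    (hK' _ _).2 ⟨(𝟙_ (Over S')).left.affineCover, fun j => ⟨σ, by
      rw [show (𝟙_ (Over S')).hom ≫ ((σ : (A.baseChange p).Sections)).left = (σ : (A.baseChange p).Sections).left from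
        Category.id_comp _]⟩⟩
  obtain ⟨hat, π, hπ, hfin, het, hsurj, P, hker, h1, h2, h3, h4, h5⟩ :=
    (A.baseChange p).exists_quotient_poincare_of_constant_sections_of_isLocallyNoetherian hA'
      (hasRank_pullback (pullback.fst A.X.hom p) hL)
      (A.pullback_unitSection_detClass_baseChange_eq_one p hL hε) K' hKinj hKL
  exact ⟨hat, π, hπ, hfin, het, hsurj, P, fun T u => (hker T u).trans (hK' T u).symm, h1, h2, h3, h4, h5⟩

end AbelianSchemeOver

end Literature.AlgebraicGeometry.AbelianSchemes

end
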